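import Summits.QuantumFields.YangMills.Theorems.FluctuationComparisonRegPrIntLS2BetaChartContBlindFibredChart
import HarnessLib

/-!
# CHART∞ · V-a (LINE g18-1 `semiclassical_s2beta`, organ S2β, LAPLACE row): the COMPACT PIVOT-BLIND CARRIER of a fibred chart at a coarse datum

R3 = Bałaban's UV-stability programme on the finite 3-torus, gauge group `SU(N)` (generic `(P, N)` here) — NOT d = 4, NOT infinite volume, NOT a mass gap,
NOT Clay; the Yang–Mills gap is NOT proved by anything in this file.  Helper toward crux `stmt-QuantumFields-20520` (`FluctuationComparisonRegPrIntL`),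
LINE g18-1, LAPLACE row, letter CHART∞ (V) «docking edition», part (a) of w3-20520 g13's FINAL HANDOFF.

ABSTRACT LEMMAS over a fibred chart `(Φ, Jac, T)` of the `n`-fold averaging `Ū⁽ⁿ⁾` (the conjuncts of ✓`exists_fibredChart_iter_cont_blind` enter as
HYPOTHESES, so that the lemmas apply verbatim to every later edition of the chart).  For a coarse datum `V` and a CLOSED set `H` of fine fields with small loop
history (the closed small-field profile of record), the CARRIER is `Xc(V) := {z | (∀ c, V c ∈ T c z) ∧ Φ (V, z) ∈ H}` — the live leaf points whose CHARTED field
lies in `H`.  Proved here: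
* `continuous_extend₂` — the resampling map `(z, g) ↦ z[βₙ ↦ g]` is continuous;
* ★★ `isCompact_carrier` — `Xc(V)` is compact: it is the `z`-projection of the preimage, under the continuous resampling map, of the CLOSED set
  `{(u, g) | u ∈ H ∧ (∀ c, g c ∈ chainWindow α n u c) ∧ Ū⁽ⁿ⁾ u = V}` (closed by ✓`isClosed_chainWindowGraph`, ✓`continuousAt_iter_of_loopSmall` on `H`, `H` closed)
  in the compact `SU(N)^{bonds} × SU(N)^{pivots}`; the two inclusions are `charted` + `fib` and `recog` + ✓`chainWindow_extend`;
* ★ `continuousOn_carrier` — `z ↦ Φ (V, z)` and `z ↦ Jac (V, z)` are `ContinuousOn Xc(V)` when `H` has STRICT small loop history (the TRANSFER conjunct (20) of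
  CHART∞ IV-c composed with `z ↦ (V, z)`);
* `extend_mem_carrier_iff` — `Xc(V)` is blind to resampling the pivots (conjuncts (17)(18));
* `isOpen_coe_preimage_of_continuousOn` — relative openness of `{z ∈ Xc | f z ∈ S}` for `f` continuous on `Xc` and `S` open (the `hOrel` row shape of
  ✓`…S2BetaLaplaceInst.laplaceLimit_of_charts`).
[cite: Balaban1987RG1, (0.4) p.253, (2.4) p.266 and (2.10) p.267]
-/

noncomputable section

open MeasureTheory Filter Topology Set
open scoped ENNReal NNReal
open Literature.MathematicalPhysics.QuantumFieldTheory.Balaban1983to89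
open Literature.MathematicalPhysics.QuantumFieldTheory.Balaban1983to89.T4Continuum

namespace Summit.QuantumFields.YangMills.Theorems.FluctuationComparisonRegPrIntLS2BetaChartContCarrier

open Summit.QuantumFields.YangMills.Theorems.FluctuationComparisonRegPrIntLWregChain
open Summit.QuantumFields.YangMills.Theorems.FluctuationComparisonRegPrIntLWregFibredChart
open Summit.QuantumFields.YangMills.Theorems.FluctuationComparisonRegPrIntLWregChartCharge (continuousAt_iter_of_loopSmall)
open Summit.QuantumFields.YangMills.Theorems.FluctuationComparisonRegPrIntLS2BetaChartContChainCharts (isClosed_chainWindowGraph)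
open Function
open Literature.MathematicalPhysics.QuantumFieldTheory.Balaban1983to89.BlockAveraging (Idx loopHol)
open Literature.MathematicalPhysics.QuantumFieldTheory.Balaban1983to89.ExpMeanLog (expMeanLogSU deltaSU)
open Literature.MathematicalPhysics.QuantumFieldTheory.Balaban1983to89.Node00 (SU)

variable {P : Params} {N : ℕ} [NeZero N]

/-! ## §1 The resampling map -/

omit [NeZero N] in
/-- The RESAMPLING MAP `(z, g) ↦ z[βₙc ↦ g c]` is continuous (coordinatewise it is either `g c` or `z b`). [folklore] -/
theorem continuous_extend₂ {n : ℕ} (hn : n ≤ P.m + P.K) :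
    Continuous fun q : GaugeField P 0 (SU N) × (PBond P n → SU N) => (extend (iterCentralBond n) q.2 q.1 : GaugeField P 0 (SU N)) := by
  have hβ := iterCentralBond_injective (P := P) (n := n) hn
  refine continuous_pi fun b => ?_
  by_cases hb : ∃ c, iterCentralBond n c = b
  · obtain ⟨c, rfl⟩ := hb
    have h1 : (fun q : GaugeField P 0 (SU N) × (PBond P n → SU N) => extend (iterCentralBond n) q.2 q.1 (iterCentralBond n c)) =
        fun q => q.2 c := funext fun q => hβ.extend_apply _ _ _
    rw [h1]
    exact (continuous_apply c).comp continuous_snd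
  · have h1 : (fun q : GaugeField P 0 (SU N) × (PBond P n → SU N) => extend (iterCentralBond n) q.2 q.1 b) = fun q => q.1 b :=
      funext fun q => extend_apply' _ _ _ hb
    rw [h1]
    exact (continuous_apply b).comp continuous_fst

/-- At a live leaf point the chart value IS the resampling of `z` at its own pivot entries (conjunct `charted`, first half). [cite: Balaban1987RG1, (2.10) p.267] -/
theorem extend_chart_pivots_eq {α : ℝ} {n : ℕ} (hn : n ≤ P.m + P.K)
    {Φ : GaugeField P n (SU N) × GaugeField P 0 (SU N) → GaugeField P 0 (SU N)}
    {T : PBond P n → GaugeField P 0 (SU N) → Set (SU N)}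
    (hcharted : ∀ V z, (∀ c, V c ∈ T c z) → (∀ b, (∀ c, iterCentralBond n c ≠ b) → Φ (V, z) b = z b) ∧
        ∀ c, Φ (V, z) (iterCentralBond n c) ∈ chainWindow (N := N) α n (Φ (V, z)) c)
    (V : GaugeField P n (SU N)) (z : GaugeField P 0 (SU N)) (hV : ∀ c, V c ∈ T c z) :
    extend (iterCentralBond n) (fun c => Φ (V, z) (iterCentralBond n c)) z = Φ (V, z) := by
  have hβ := iterCentralBond_injective (P := P) (n := n) hn
  funext b
  by_cases hb : ∃ c, iterCentralBond n c = b
  · obtain ⟨c, rfl⟩ := hb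
    exact hβ.extend_apply _ _ _
  · rw [extend_apply' _ _ _ hb]
    exact ((hcharted V z hV).1 b fun c hc => hb ⟨c, hc⟩).symm

/-! ## §2 The carrier is compact -/

/-- ★★ **THE CARRIER IS COMPACT**: for a closed set `H` of fine fields with small loop history below level `n` (`≤ α < δ_N`), the set of live leaf points over `V`
whose charted field lies in `H`, `{z | (∀ c, V c ∈ T c z) ∧ Φ (V, z) ∈ H}`, is compact — it is the first projection of the preimage under the continuous
resampling map `(z, g) ↦ (z[βₙ ↦ g], g)` of the closed set `{(u, g) | u ∈ H ∧ (∀ c, g c ∈ chainWindow α n u c) ∧ Ū⁽ⁿ⁾ u = V}`.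
[cite: Balaban1987RG1, (0.4) p.253, (2.4) p.266 and (2.10) p.267] -/
theorem isCompact_carrier {α : ℝ} (hαδ : α < deltaSU (Fin N)) {n : ℕ} (hn : n ≤ P.m + P.K)
    {Φ : GaugeField P n (SU N) × GaugeField P 0 (SU N) → GaugeField P 0 (SU N)} {Jac : GaugeField P n (SU N) × GaugeField P 0 (SU N) → ℝ≥0}
    {T : PBond P n → GaugeField P 0 (SU N) → Set (SU N)}
    (hfib : ∀ V z, Jac (V, z) ≠ 0 →
      Averaging.iter (fun i => BlockAveraging.blockAvg (P := P) (j := i) (expMeanLogSU (n := Fin N))) n (Φ (V, z)) = V)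
    (hJT : ∀ V z, Jac (V, z) ≠ 0 ↔ ∀ c, V c ∈ T c z)
    (hcharted : ∀ V z, (∀ c, V c ∈ T c z) → (∀ b, (∀ c, iterCentralBond n c ≠ b) → Φ (V, z) b = z b) ∧
        ∀ c, Φ (V, z) (iterCentralBond n c) ∈ chainWindow (N := N) α n (Φ (V, z)) c)
    (hrecog : ∀ V z (g : PBond P n → SU N), (∀ c, g c ∈ chainWindow (N := N) α n z c) →
        (∀ c, V c = Averaging.iter (fun i => BlockAveraging.blockAvg (P := P) (j := i) (expMeanLogSU (n := Fin N))) n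
          (extend (iterCentralBond n) g z) c) →
        Jac (V, z) ≠ 0 ∧ Φ (V, z) = extend (iterCentralBond n) g z)
    {H : Set (GaugeField P 0 (SU N))} (hH : IsClosed H)
    (hHsub : H ⊆ {U | ∀ k, k < n → ∀ (c' : PBond P (k + 1)) (i : Idx P),
        dist1 (loopHol (Averaging.iter (fun i => BlockAveraging.blockAvg (P := P) (j := i) (expMeanLogSU (n := Fin N))) k U) c' i) ≤ α})
    (V : GaugeField P n (SU N)) :
    IsCompact {z : GaugeField P 0 (SU N) | (∀ c, V c ∈ T c z) ∧ Φ (V, z) ∈ H} := by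
  classical
  haveI : CompactSpace (GaugeField P 0 (SU N)) := inferInstanceAs (CompactSpace (PBond P 0 → SU N))
  haveI : T2Space (GaugeField P n (SU N)) := inferInstanceAs (T2Space (PBond P n → SU N))
  set A := Averaging.iter (fun i => BlockAveraging.blockAvg (P := P) (j := i) (expMeanLogSU (n := Fin N))) n with hA
  -- the closed set upstairs, presented by its membership predicate
  obtain ⟨G, hGiff, hGc⟩ : ∃ G : Set (GaugeField P 0 (SU N) × (PBond P n → SU N)),
      (∀ q, q ∈ G ↔ q.1 ∈ H ∧ (∀ c, q.2 c ∈ chainWindow (N := N) α n q.1 c) ∧ A q.1 = V) ∧ IsClosed G := by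
    refine ⟨{q | q.1 ∈ H ∧ (∀ c, q.2 c ∈ chainWindow (N := N) α n q.1 c) ∧ A q.1 = V}, fun q => Iff.rfl, ?_⟩
    have h1 : IsClosed {q : GaugeField P 0 (SU N) × (PBond P n → SU N) | q.1 ∈ H} := hH.preimage continuous_fst
    have h2 : ∀ c : PBond P n, IsClosed {q : GaugeField P 0 (SU N) × (PBond P n → SU N) | q.1 ∈ H ∧ q.2 c ∈ chainWindow (N := N) α n q.1 c} := by
      intro c
      have hι : Continuous fun q : GaugeField P 0 (SU N) × (PBond P n → SU N) => ((q.1, q.2 c) : GaugeField P 0 (SU N) × SU N) :=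
        continuous_fst.prodMk ((continuous_apply c).comp continuous_snd)
      have hW := (isClosed_chainWindowGraph (P := P) (N := N) hαδ hn c).preimage hι
      have heq : {q : GaugeField P 0 (SU N) × (PBond P n → SU N) | q.1 ∈ H ∧ q.2 c ∈ chainWindow (N := N) α n q.1 c} =
          {q : GaugeField P 0 (SU N) × (PBond P n → SU N) | q.1 ∈ H} ∩
            (fun q : GaugeField P 0 (SU N) × (PBond P n → SU N) => ((q.1, q.2 c) : GaugeField P 0 (SU N) × SU N)) ⁻¹'
              {p : GaugeField P 0 (SU N) × SU N |
                (∀ k, k < n → ∀ (c' : PBond P (k + 1)) (i : Idx P),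
                  dist1 (loopHol (Averaging.iter (fun i => BlockAveraging.blockAvg (P := P) (j := i) (expMeanLogSU (n := Fin N))) k p.1) c' i) ≤ α) ∧
                p.2 ∈ chainWindow (N := N) α n p.1 c} := by
        ext q
        constructor
        · rintro ⟨hq1, hq2⟩
          exact ⟨hq1, hHsub hq1, hq2⟩
        · rintro ⟨hq1, -, hq2⟩
          exact ⟨hq1, hq2⟩
      rw [heq]
      exact h1.inter hW
    have h3 : IsClosed {q : GaugeField P 0 (SU N) × (PBond P n → SU N) | q.1 ∈ H ∧ A q.1 = V} := by
      have hcont : ContinuousOn A H := fun U hU => (continuousAt_iter_of_loopSmall (P := P) (N := N) hαδ U (hHsub hU)).continuousWithinAt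
      have hcl : IsClosed (H ∩ A ⁻¹' {V}) := hcont.preimage_isClosed_of_isClosed hH isClosed_singleton
      exact hcl.preimage continuous_fst
    have heq : {q : GaugeField P 0 (SU N) × (PBond P n → SU N) | q.1 ∈ H ∧ (∀ c, q.2 c ∈ chainWindow (N := N) α n q.1 c) ∧ A q.1 = V} =
        (⋂ c, {q : GaugeField P 0 (SU N) × (PBond P n → SU N) | q.1 ∈ H ∧ q.2 c ∈ chainWindow (N := N) α n q.1 c}) ∩
          {q : GaugeField P 0 (SU N) × (PBond P n → SU N) | q.1 ∈ H ∧ A q.1 = V} := by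
      ext q
      simp only [mem_setOf_eq, mem_inter_iff, mem_iInter]
      constructor
      · rintro ⟨hq1, hq2, hq3⟩
        exact ⟨fun c => ⟨hq1, hq2 c⟩, hq1, hq3⟩
      · rintro ⟨hq2, hq1, hq3⟩
        exact ⟨hq1, fun c => (hq2 c).2, hq3⟩
    rw [heq]
    exact (isClosed_iInter h2).inter h3
  -- pull back along the (continuous) resampling map; compactness upstairs
  have hRc : Continuous fun q : GaugeField P 0 (SU N) × (PBond P n → SU N) =>
      ((extend (iterCentralBond n) q.2 q.1, q.2) : GaugeField P 0 (SU N) × (PBond P n → SU N)) :=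
    (continuous_extend₂ (P := P) (N := N) hn).prodMk continuous_snd
  have hKc : IsCompact ((fun q : GaugeField P 0 (SU N) × (PBond P n → SU N) =>
      ((extend (iterCentralBond n) q.2 q.1, q.2) : GaugeField P 0 (SU N) × (PBond P n → SU N))) ⁻¹' G) :=
    (hGc.preimage hRc).isCompact
  -- the carrier is its first projection
  have himage : Prod.fst '' ((fun q : GaugeField P 0 (SU N) × (PBond P n → SU N) =>
      ((extend (iterCentralBond n) q.2 q.1, q.2) : GaugeField P 0 (SU N) × (PBond P n → SU N))) ⁻¹' G) =
      {z : GaugeField P 0 (SU N) | (∀ c, V c ∈ T c z) ∧ Φ (V, z) ∈ H} := by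
    ext z
    constructor
    · rintro ⟨q, hq, rfl⟩
      obtain ⟨hqH, hqW, hqA⟩ := (hGiff _).1 hq
      have hwin : ∀ c, q.2 c ∈ chainWindow (N := N) α n q.1 c := fun c => by
        rw [← chainWindow_extend α hn q.2 q.1 c]
        exact hqW c
      obtain ⟨hJ, hΦ⟩ := hrecog V q.1 q.2 hwin fun c => by rw [hqA]
      exact ⟨(hJT V q.1).1 hJ, by rw [hΦ]; exact hqH⟩
    · rintro ⟨hV, hΦH⟩
      refine ⟨(z, fun c => Φ (V, z) (iterCentralBond n c)), ?_, rfl⟩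
      have hext := extend_chart_pivots_eq (P := P) (N := N) hn hcharted V z hV
      show ((extend (iterCentralBond n) (fun c => Φ (V, z) (iterCentralBond n c)) z, fun c => Φ (V, z) (iterCentralBond n c)) :
          GaugeField P 0 (SU N) × (PBond P n → SU N)) ∈ G
      rw [hGiff, hext]
      exact ⟨hΦH, (hcharted V z hV).2, hfib V z ((hJT V z).2 hV)⟩
  rw [← himage]
  exact hKc.image continuous_fst

/-! ## §3 Continuity on the carrier, blindness, relative openness -/

/-- ★ **THE CHART AND ITS JACOBIAN ARE CONTINUOUS ON THE CARRIER** (for fixed `V`), whenever `H` has STRICT small loop history below level `n`: the TRANSFER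
conjunct (20) of CHART∞ IV-c composed with `z ↦ (V, z)`, which maps the carrier into the pivot-blind window graph. [cite: Balaban1987RG1, (2.10) p.267] -/
theorem continuousOn_carrier {α : ℝ} {n : ℕ}
    {Φ : GaugeField P n (SU N) × GaugeField P 0 (SU N) → GaugeField P 0 (SU N)} {Jac : GaugeField P n (SU N) × GaugeField P 0 (SU N) → ℝ≥0}
    {T : PBond P n → GaugeField P 0 (SU N) → Set (SU N)}
    (htransfer : ∀ (V : GaugeField P n (SU N)) (z₀ : GaugeField P 0 (SU N)), (∀ c, V c ∈ T c z₀) →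
        (∀ k, k < n → ∀ (c' : PBond P (k + 1)) (i : Idx P),
          dist1 (loopHol (Averaging.iter (fun i => BlockAveraging.blockAvg (P := P) (j := i) (expMeanLogSU (n := Fin N))) k (Φ (V, z₀))) c' i) < α) →
        ContinuousWithinAt Φ {p : GaugeField P n (SU N) × GaugeField P 0 (SU N) | ∀ c, p.1 c ∈ T c p.2} (V, z₀) ∧
        ContinuousWithinAt Jac {p : GaugeField P n (SU N) × GaugeField P 0 (SU N) | ∀ c, p.1 c ∈ T c p.2} (V, z₀))
    {H : Set (GaugeField P 0 (SU N))}
    (hHlt : H ⊆ {U | ∀ k, k < n → ∀ (c' : PBond P (k + 1)) (i : Idx P),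
        dist1 (loopHol (Averaging.iter (fun i => BlockAveraging.blockAvg (P := P) (j := i) (expMeanLogSU (n := Fin N))) k U) c' i) < α})
    (V : GaugeField P n (SU N)) :
    ContinuousOn (fun z => Φ (V, z)) {z : GaugeField P 0 (SU N) | (∀ c, V c ∈ T c z) ∧ Φ (V, z) ∈ H} ∧
      ContinuousOn (fun z => Jac (V, z)) {z : GaugeField P 0 (SU N) | (∀ c, V c ∈ T c z) ∧ Φ (V, z) ∈ H} := by
  have hι : Continuous fun z : GaugeField P 0 (SU N) => ((V, z) : GaugeField P n (SU N) × GaugeField P 0 (SU N)) :=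
    continuous_const.prodMk continuous_id
  have hmaps : MapsTo (fun z : GaugeField P 0 (SU N) => ((V, z) : GaugeField P n (SU N) × GaugeField P 0 (SU N)))
      {z : GaugeField P 0 (SU N) | (∀ c, V c ∈ T c z) ∧ Φ (V, z) ∈ H}
      {p : GaugeField P n (SU N) × GaugeField P 0 (SU N) | ∀ c, p.1 c ∈ T c p.2} := fun z hz => hz.1
  refine ⟨fun z₀ hz₀ => ?_, fun z₀ hz₀ => ?_⟩
  · exact ContinuousWithinAt.comp (f := fun z : GaugeField P 0 (SU N) => ((V, z) : GaugeField P n (SU N) × GaugeField P 0 (SU N))) (x := z₀)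
      (htransfer V z₀ hz₀.1 (hHlt hz₀.2)).1 hι.continuousWithinAt hmaps
  · exact ContinuousWithinAt.comp (f := fun z : GaugeField P 0 (SU N) => ((V, z) : GaugeField P n (SU N) × GaugeField P 0 (SU N))) (x := z₀)
      (htransfer V z₀ hz₀.1 (hHlt hz₀.2)).2 hι.continuousWithinAt hmaps

omit [NeZero N] in
/-- **THE CARRIER IS PIVOT-BLIND**: resampling the pivot entries of `z` does not change membership (conjuncts (17) `T` blind and (18) `Φ` blind).
[cite: Balaban1987RG1, (0.4) p.253 (bookkeeping)] -/
theorem extend_mem_carrier_iff {n : ℕ}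
    {Φ : GaugeField P n (SU N) × GaugeField P 0 (SU N) → GaugeField P 0 (SU N)}
    {T : PBond P n → GaugeField P 0 (SU N) → Set (SU N)}
    (hTbl : ∀ c z (g : PBond P n → SU N), T c (extend (iterCentralBond n) g z) = T c z)
    (hΦbl : ∀ V z (g : PBond P n → SU N), (∀ c, V c ∈ T c z) → Φ (V, extend (iterCentralBond n) g z) = Φ (V, z))
    {H : Set (GaugeField P 0 (SU N))} (V : GaugeField P n (SU N)) (z : GaugeField P 0 (SU N)) (g : PBond P n → SU N) :
    extend (iterCentralBond n) g z ∈ {z : GaugeField P 0 (SU N) | (∀ c, V c ∈ T c z) ∧ Φ (V, z) ∈ H} ↔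
      z ∈ {z : GaugeField P 0 (SU N) | (∀ c, V c ∈ T c z) ∧ Φ (V, z) ∈ H} := by
  have hT : ∀ c, V c ∈ T c (extend (iterCentralBond n) g z) ↔ V c ∈ T c z := fun c => by rw [hTbl c z g]
  simp only [mem_setOf_eq]
  constructor
  · rintro ⟨hV, hΦ⟩
    have hV' : ∀ c, V c ∈ T c z := fun c => (hT c).1 (hV c)
    exact ⟨hV', by rwa [hΦbl V z g hV'] at hΦ⟩
  · rintro ⟨hV, hΦ⟩
    exact ⟨fun c => (hT c).2 (hV c), by rwa [hΦbl V z g hV]⟩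

/-- The `hOrel` row shape: for `f` continuous on `X` and `S` open, `{z ∈ X | f z ∈ S}` is open in the subtype `↥X`. [folklore] -/
theorem isOpen_coe_preimage_of_continuousOn {X Y : Type*} [TopologicalSpace X] [TopologicalSpace Y] {A : Set X} {f : X → Y}
    (hf : ContinuousOn f A) {S : Set Y} (hS : IsOpen S) :
    IsOpen ((Subtype.val : A → X) ⁻¹' {z | f z ∈ S}) := by
  have hc : Continuous (A.restrict f) := continuousOn_iff_continuous_restrict.1 hf
  exact hS.preimage hc

omit [NeZero N] in
/-- The `hvan`-type inclusion: a point where the Jacobian is live and the charted field lies in `H` is in the carrier (conjunct (7)). [cite: Balaban1987RG1, (2.10) p.267] -/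
theorem mem_carrier_of_ne_zero {n : ℕ}
    {Φ : GaugeField P n (SU N) × GaugeField P 0 (SU N) → GaugeField P 0 (SU N)} {Jac : GaugeField P n (SU N) × GaugeField P 0 (SU N) → ℝ≥0}
    {T : PBond P n → GaugeField P 0 (SU N) → Set (SU N)}
    (hJT : ∀ V z, Jac (V, z) ≠ 0 ↔ ∀ c, V c ∈ T c z)
    {H : Set (GaugeField P 0 (SU N))} {V : GaugeField P n (SU N)} {z : GaugeField P 0 (SU N)} (hJ : Jac (V, z) ≠ 0) (hH : Φ (V, z) ∈ H) :
    z ∈ {z : GaugeField P 0 (SU N) | (∀ c, V c ∈ T c z) ∧ Φ (V, z) ∈ H} :=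
  ⟨(hJT V z).1 hJ, hH⟩

end Summit.QuantumFields.YangMills.Theorems.FluctuationComparisonRegPrIntLS2BetaChartContCarrier

end
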